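import Summits.AtomisticToContinuum.Crystallization.Theorems.OverbindingBudgetAffineCompressedCutSeed

/-!
# NODE g81 «Seed», file 2 of 2 — uniqueness of established sites and charts, seeds, the O8 normalisation of a found hcp site, re-basing, admissible bounds

Route `OverbindingBudget` (Crystallization), crux `RobustDefectLimitWindows` (stmt-AtomisticToContinuum-31280), decomp-a2c lens 4, generation 81; open leaf
NS♭₂ ⟸ 79K ⟸ LR(r₁) ⟸ R1 → R2 «Seed» (file 1 `…CompressedCutSeed`: layer lattice + `layer_disc`) → R3 → R4.

WHAT THIS FILE PROVES (potential-free, sorry-free).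
* §1 UNIQUENESS (order-independence of the establishment output): `estab_site_unique` (one label, resolving positions `D + D′ < nn` ⇒ one site — metric
  exclusion `…Establish.site_eq_of_close`), `estab_chart_unique` (one site, one `1`-separated copy, links `(τ + τ′)·√2 < β` against the base frame's lower
  bound ⇒ one chart — `…Establish.chart_eq_of_carries`).
* §2 SEEDS AND NORMALISATION: `seed_fcc`, `seed_hcp` (identity chart, `τ = D = 0`), `estab_recarry`, ★ `estab_normalise_hcp` (an established site charted
  onto ANY member of `hcpFamilyL` is, after ONE explicit flip of all charts and of the base frame (O8, `…EstablishTwo.estab_flip`), charted onto the aligned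
  `H` or `H′` with the same `τ, D`), `ball_rebase` (the ball hypotheses at `i` with radius `r` give those at a site `j` with `dist ≤ a` from `i` and radius
  `r − a` — the minimal-counterexample move of Step A: re-base at the NEAREST hcp site, or the `a`-ball is all-fcc).
* §3 ADMISSIBLE BOUND SEQUENCES `admissible_bounds`: for `τ₀, ν ≥ 0`, `L ≥ Λ^n` (`Λ = 1.0011`), the LINEAR link bound `τs d = τ₀ + d·η`, `η = (3/4000)·L·ν`,
  and the QUADRATIC position bound `Ds d = D₀ + d·(10⁻⁴·L·ν + τ₀) + η·d(d−1)/2` are monotone and satisfy the two step inequalities of `…Seed.layer_disc`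
  with `nn_{j₀} = ν` — so the hypotheses of the disc induction are met by explicit closed forms (R4 only has to prove the room inequality).

Deps: `…CompressedCutSeed`.  No `instance`, no `notation`, no `set_option`, no new axioms, 0 sorry.
-/


namespace Summit.AtomisticToContinuum.Crystallization.Theorems.OverbindingBudgetAffineCompressedCutSeedTwo

open Literature.Geometry.DiscreteGeometry (nearestDist nearestDist_nonneg nearestDist_le_dist fccTwoShellPattern hcpTwoShellPattern
  norm_le_sqrt_two_of_mem_twoShellPattern)
open Summit.AtomisticToContinuum.Crystallization.Theorems.OverbindingBudgetAffineCompressedCutKernel (T3 tsub tadd tsq tflip fccL hcpL fccNegL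
  hcpAltL hexL hcpFamilyL kernelOneB fccShellL kf_fcc kf_hcp e1_entries)
open Summit.AtomisticToContinuum.Crystallization.Theorems.OverbindingBudgetAffineCompressedCutCharts (mv mv_tadd mv_zero mv_injective Carries ListedBy
  listedBy_fcc listedBy_hcp norm_mv_eq_one_iff)
open Summit.AtomisticToContinuum.Crystallization.Theorems.OverbindingBudgetAffineCompressedCutEstablish (site_eq_of_close Estab estab_seed
  estab_child_one charts_close link_nonneg chart_eq_of_carries copies_separated)
open Summit.AtomisticToContinuum.Crystallization.Theorems.OverbindingBudgetAffineCompressedCutEstablishTwo (IsSign flipIso estab_flip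
  carries_hcpFamily_normalise)

open Summit.AtomisticToContinuum.Crystallization.Theorems.OverbindingBudgetAffineCompressedCutSeed (estab_mono)

variable {N : ℕ}

/-! ## §1  Uniqueness of established sites and charts (order-independence) -/

/-- **One label, one site.**  Two established sites with the same label whose position bounds resolve (`D + D′ < nn`) coincide — metric exclusion. [this file] -/
theorem estab_site_unique {y : Fin N → EuclideanSpace ℝ (Fin 3)} {A : Fin N → (EuclideanSpace ℝ (Fin 3) →ₗ[ℝ] EuclideanSpace ℝ (Fin 3))}
    {P : Fin N → Finset (EuclideanSpace ℝ (Fin 3))} {B : EuclideanSpace ℝ (Fin 3) →ₗ[ℝ] EuclideanSpace ℝ (Fin 3)} {i k k' : Fin N}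
    {M M' : EuclideanSpace ℝ (Fin 3) →ₗᵢ[ℝ] EuclideanSpace ℝ (Fin 3)} {C C' : List T3} {q : T3} {τ τ' D D' : ℝ}
    (hE : Estab y A P B i k M C q τ D) (hE' : Estab y A P B i k' M' C' q τ' D') (h : D + D' < nearestDist y k') : k = k' :=
  site_eq_of_close hE.2.2 hE'.2.2 h

/-- **One site, one chart.**  Two charts of one established site onto the same `1`-separated copy, whose links are small against the lower bound `β` of the
base frame (`(τ + τ′)·√2 < β`), are equal. [this file] -/
theorem estab_chart_unique {y : Fin N → EuclideanSpace ℝ (Fin 3)} {A : Fin N → (EuclideanSpace ℝ (Fin 3) →ₗ[ℝ] EuclideanSpace ℝ (Fin 3))}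
    {P : Fin N → Finset (EuclideanSpace ℝ (Fin 3))} {B : EuclideanSpace ℝ (Fin 3) →ₗ[ℝ] EuclideanSpace ℝ (Fin 3)} {β : ℝ} {i k : Fin N}
    {M M' : EuclideanSpace ℝ (Fin 3) →ₗᵢ[ℝ] EuclideanSpace ℝ (Fin 3)} {C : List T3} {q q' : T3} {τ τ' D D' : ℝ}
    (hPk : P k = fccTwoShellPattern ∨ P k = hcpTwoShellPattern) (hB : ∀ z, β * ‖z‖ ≤ ‖B z‖)
    (hE : Estab y A P B i k M C q τ D) (hE' : Estab y A P B i k M' C q' τ' D') (hsep : ∀ V ∈ C, ∀ W ∈ C, V ≠ W → 18 ≤ tsq (tsub V W))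
    (hsmall : (τ + τ') * Real.sqrt 2 < β) : ∀ x, M x = M' x := by
  have hcl := charts_close hB hE.2.1 hE'.2.1
  have hτ := link_nonneg hE.2.1
  have hτ' := link_nonneg hE'.2.1
  have hβ : 0 < β := lt_of_le_of_lt (mul_nonneg (by linarith) (Real.sqrt_nonneg 2)) hsmall
  have hclose : ∀ v ∈ P k, ‖M v - M' v‖ < 1 := by
    intro v hv
    have h1 := hcl v
    have h2 : ‖v‖ ≤ Real.sqrt 2 := norm_le_sqrt_two_of_mem_twoShellPattern hPk hv
    have h3 : (τ + τ') * ‖v‖ ≤ (τ + τ') * Real.sqrt 2 := mul_le_mul_of_nonneg_left h2 (by linarith)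
    exact (mul_lt_iff_lt_one_right hβ).1 (by linarith)
  rcases hPk with hPk | hPk
  · exact chart_eq_of_carries (Or.inl rfl) (by rw [hPk]; exact listedBy_fcc) hsep hE.1 hE'.1 hclose
  · exact chart_eq_of_carries (Or.inr rfl) (by rw [hPk]; exact listedBy_hcp) hsep hE.1 hE'.1 hclose

/-! ## §2  Seeds, the O8 normalisation of a found hcp site, re-basing -/

/-- Seed at an fcc base site: identity chart onto `F⁺`. [this file] -/
theorem seed_fcc {y : Fin N → EuclideanSpace ℝ (Fin 3)} {A : Fin N → (EuclideanSpace ℝ (Fin 3) →ₗ[ℝ] EuclideanSpace ℝ (Fin 3))}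
    {P : Fin N → Finset (EuclideanSpace ℝ (Fin 3))} {i : Fin N} (hPi : P i = fccTwoShellPattern) :
    Estab y A P (nearestDist y i • A i) i i LinearIsometry.id fccL (0, 0, 0) 0 0 :=
  estab_seed (by rw [hPi]; exact listedBy_fcc)

/-- Seed at an hcp base site: identity chart onto `H`. [this file] -/
theorem seed_hcp {y : Fin N → EuclideanSpace ℝ (Fin 3)} {A : Fin N → (EuclideanSpace ℝ (Fin 3) →ₗ[ℝ] EuclideanSpace ℝ (Fin 3))}
    {P : Fin N → Finset (EuclideanSpace ℝ (Fin 3))} {i : Fin N} (hPi : P i = hcpTwoShellPattern) :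
    Estab y A P (nearestDist y i • A i) i i LinearIsometry.id hcpL (0, 0, 0) 0 0 :=
  estab_seed (by rw [hPi]; exact listedBy_hcp)

/-- Replacing the copy clause of an established site by another chart statement for the same chart. [this file] -/
theorem estab_recarry {y : Fin N → EuclideanSpace ℝ (Fin 3)} {A : Fin N → (EuclideanSpace ℝ (Fin 3) →ₗ[ℝ] EuclideanSpace ℝ (Fin 3))}
    {P : Fin N → Finset (EuclideanSpace ℝ (Fin 3))} {B : EuclideanSpace ℝ (Fin 3) →ₗ[ℝ] EuclideanSpace ℝ (Fin 3)} {i j : Fin N}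
    {M : EuclideanSpace ℝ (Fin 3) →ₗᵢ[ℝ] EuclideanSpace ℝ (Fin 3)} {C C' : List T3} {lam : T3} {τ D : ℝ}
    (hE : Estab y A P B i j M C lam τ D) (hC : Carries M (P j) C') : Estab y A P B i j M C' lam τ D :=
  ⟨hC, hE.2.1, hE.2.2⟩

/-- ★ **O8 NORMALISATION OF A FOUND HCP SITE.**  A site established with a chart onto ANY member of `hcpFamilyL` (the output of `kf_hcp` at the first hcp
child of an fcc-charted parent) is — after ONE explicit coordinate flip `Φ_s` composed with every chart and with the base frame — established with the
same `τ, D` and a chart onto the aligned `H` or `H′`. [this file] -/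
theorem estab_normalise_hcp {y : Fin N → EuclideanSpace ℝ (Fin 3)} {A : Fin N → (EuclideanSpace ℝ (Fin 3) →ₗ[ℝ] EuclideanSpace ℝ (Fin 3))}
    {P : Fin N → Finset (EuclideanSpace ℝ (Fin 3))} {B : EuclideanSpace ℝ (Fin 3) →ₗ[ℝ] EuclideanSpace ℝ (Fin 3)} {i j : Fin N}
    {M : EuclideanSpace ℝ (Fin 3) →ₗᵢ[ℝ] EuclideanSpace ℝ (Fin 3)} {Q : List T3} {lam : T3} {τ D : ℝ}
    (hQ : Q ∈ hcpFamilyL) (hE : Estab y A P B i j M Q lam τ D) :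
    ∃ s : T3, ∃ hs : IsSign s, ∃ C' : List T3, (C' = hcpL ∨ C' = hcpAltL) ∧
      Estab y A P (B ∘ₗ (flipIso s hs).toLinearMap) i j ((flipIso s hs).comp M) C' (tflip s lam) τ D := by
  obtain ⟨s, hs, h⟩ := carries_hcpFamily_normalise hQ hE.1
  have hE' := estab_flip hs hE
  rcases h with h | h
  · exact ⟨s, hs, hcpL, Or.inl rfl, estab_recarry hE' h⟩
  · exact ⟨s, hs, hcpAltL, Or.inr rfl, estab_recarry hE' h⟩

/-- **RE-BASING** (the minimal-counterexample move of Step A).  A ball hypothesis at `i` with radius `r` yields the same hypothesis at any site `j` with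
`dist (y j) (y i) ≤ a` and radius `r − a`. [this file] -/
theorem ball_rebase {y : Fin N → EuclideanSpace ℝ (Fin 3)} {i j : Fin N} {a r : ℝ} {X : Fin N → Prop} (hji : dist (y j) (y i) ≤ a)
    (h : ∀ k, dist (y k) (y i) ≤ r → X k) : ∀ k, dist (y k) (y j) ≤ r - a → X k := by
  intro k hk
  apply h
  have := dist_triangle (y k) (y j) (y i)
  linarith


/-! ## §3  Admissible bound sequences for the disc induction -/

/-- `Λ^d ≤ L` below `n` when `Λ^n ≤ L` (`Λ = 1.0011 ≥ 1`). [this file] -/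
theorem pow_le_of_le {L : ℝ} {n d : ℕ} (hL : (10011 / 10000 : ℝ) ^ n ≤ L) (hd : d ≤ n) : (10011 / 10000 : ℝ) ^ d ≤ L :=
  (pow_le_pow_right₀ (by norm_num) hd).trans hL

/-- ★ **ADMISSIBLE BOUNDS.**  The linear link bound `τs d = τ₀ + d·η` with `η = (3/4000)·L·ν` and the quadratic position bound
`Ds d = D₀ + d·(10⁻⁴·L·ν + τ₀) + η·d·(d − 1)/2` are monotone and satisfy the step inequalities of `…Seed.layer_disc` (with `nearestDist y j₀ = ν`) below `n`,
whenever `0 ≤ τ₀`, `0 ≤ ν` and `Λ^n ≤ L`. [this file] -/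
theorem admissible_bounds {τ₀ D₀ ν L : ℝ} (hτ₀ : 0 ≤ τ₀) (hν : 0 ≤ ν) {n : ℕ} (hL : (10011 / 10000 : ℝ) ^ n ≤ L) :
    Monotone (fun d : ℕ => τ₀ + (d : ℝ) * (3 / 4000 * L * ν)) ∧
    Monotone (fun d : ℕ => D₀ + (d : ℝ) * (1 / 10 ^ 4 * L * ν + τ₀) + 3 / 4000 * L * ν * (d : ℝ) * ((d : ℝ) - 1) / 2) ∧
    (∀ d : ℕ, d + 1 ≤ n → (τ₀ + (d : ℝ) * (3 / 4000 * L * ν)) + 5 / 2 * (2 * (1 / 10 ^ 4) * ((10011 / 10000 : ℝ) ^ d * ν) +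
      1 / 10 ^ 4 * ((10011 / 10000 : ℝ) ^ (d + 1) * ν)) ≤ τ₀ + ((d + 1 : ℕ) : ℝ) * (3 / 4000 * L * ν)) ∧
    (∀ d : ℕ, d + 1 ≤ n → (D₀ + (d : ℝ) * (1 / 10 ^ 4 * L * ν + τ₀) + 3 / 4000 * L * ν * (d : ℝ) * ((d : ℝ) - 1) / 2) +
      1 / 10 ^ 4 * ((10011 / 10000 : ℝ) ^ d * ν) + (τ₀ + (d : ℝ) * (3 / 4000 * L * ν)) ≤
      D₀ + ((d + 1 : ℕ) : ℝ) * (1 / 10 ^ 4 * L * ν + τ₀) + 3 / 4000 * L * ν * ((d + 1 : ℕ) : ℝ) * (((d + 1 : ℕ) : ℝ) - 1) / 2) := by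
  have hL0 : 0 ≤ L := le_trans (pow_nonneg (by norm_num) n) hL
  have hη : 0 ≤ 3 / 4000 * L * ν := by positivity
  refine ⟨?_, ?_, ?_, ?_⟩
  · refine monotone_nat_of_le_succ fun d => ?_
    push_cast
    nlinarith
  · refine monotone_nat_of_le_succ fun d => ?_
    have hd : (0 : ℝ) ≤ d := Nat.cast_nonneg d
    have e : D₀ + ((d + 1 : ℕ) : ℝ) * (1 / 10 ^ 4 * L * ν + τ₀) + 3 / 4000 * L * ν * ((d + 1 : ℕ) : ℝ) * (((d + 1 : ℕ) : ℝ) - 1) / 2 -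
        (D₀ + (d : ℝ) * (1 / 10 ^ 4 * L * ν + τ₀) + 3 / 4000 * L * ν * (d : ℝ) * ((d : ℝ) - 1) / 2) =
        (1 / 10 ^ 4 * L * ν + τ₀) + 3 / 4000 * L * ν * (d : ℝ) := by
      push_cast; ring
    have h1 : 0 ≤ 1 / 10 ^ 4 * L * ν + τ₀ := by positivity
    have h2 : 0 ≤ 3 / 4000 * L * ν * (d : ℝ) := mul_nonneg hη hd
    linarith
  · intro d hd
    have h1 : (10011 / 10000 : ℝ) ^ d ≤ L := pow_le_of_le hL ((Nat.le_succ d).trans hd)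
    have h2 : (10011 / 10000 : ℝ) ^ (d + 1) ≤ L := pow_le_of_le hL hd
    have h3 : (10011 / 10000 : ℝ) ^ d * ν ≤ L * ν := mul_le_mul_of_nonneg_right h1 hν
    have h4 : (10011 / 10000 : ℝ) ^ (d + 1) * ν ≤ L * ν := mul_le_mul_of_nonneg_right h2 hν
    have e : τ₀ + ((d + 1 : ℕ) : ℝ) * (3 / 4000 * L * ν) = (τ₀ + (d : ℝ) * (3 / 4000 * L * ν)) + 3 / 4000 * (L * ν) := by
      push_cast; ring
    rw [e]
    linarith
  · intro d hd
    have h1 : (10011 / 10000 : ℝ) ^ d ≤ L := pow_le_of_le hL ((Nat.le_succ d).trans hd)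
    have h3 : (10011 / 10000 : ℝ) ^ d * ν ≤ L * ν := mul_le_mul_of_nonneg_right h1 hν
    have e : D₀ + ((d + 1 : ℕ) : ℝ) * (1 / 10 ^ 4 * L * ν + τ₀) + 3 / 4000 * L * ν * ((d + 1 : ℕ) : ℝ) * (((d + 1 : ℕ) : ℝ) - 1) / 2 =
        (D₀ + (d : ℝ) * (1 / 10 ^ 4 * L * ν + τ₀) + 3 / 4000 * L * ν * (d : ℝ) * ((d : ℝ) - 1) / 2) +
        1 / 10 ^ 4 * (L * ν) + (τ₀ + (d : ℝ) * (3 / 4000 * L * ν)) := by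
      push_cast; ring
    rw [e]
    linarith

end Summit.AtomisticToContinuum.Crystallization.Theorems.OverbindingBudgetAffineCompressedCutSeedTwo
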